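import Summits.AtomisticToContinuum.HydrodynamicLimit.Theorems.InformationPercolationEnginePercolationClosesChaosForecastSwap
import Summits.AtomisticToContinuum.HydrodynamicLimit.Theorems.InformationPercolationEnginePercolationClosesChaosForecastBadForecastRare
import Summits.AtomisticToContinuum.HydrodynamicLimit.Theorems.InformationPercolationEnginePercolationClosesChaosForecastNonGoodRare
import Summits.AtomisticToContinuum.HydrodynamicLimit.Theorems.InformationPercolationEnginePercolationClosesChaosRevealedSandwich
import Summits.AtomisticToContinuum.HydrodynamicLimit.Theorems.InformationPercolationEnginePercolationClosesChaosForecastAlgebra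
import HarnessLib

/-!
# Forecast transfer S6 of the line `equilibrium-forecast-chain-rule` (crux `InformationPercolationEngine.PercolationClosesChaos`,
stmt-AtomisticToContinuum-15178) — the registered stub `stub_forecastTransfer` of skeleton v5, CLOSED

Support file (`--supports stmt-AtomisticToContinuum-15178`): the registered stub S6 of the line's skeleton
(`Cruxes/PercolationClosesChaos/Lines/equilibrium_forecast_chain_rule.lean`, v5),
`stub_forecastTransfer : MesoForecastChaos → LocalCountUI → NoKineticIrregularity → CoarseLocalMaxwellianity → RevealedDefectStability →
KineticCellChaosLG` — kinetic-cell chaos under the EVOLVED law from forecast chaos under the INVARIANT law plus the LG-side inputs —, as the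
composition of the landed architecture `kineticCellChaosLG_of : ForecastSwap → BadForecastRare → NonGoodRare → RevealedSandwich → ForecastAlgebra →
KineticCellChaosLG` (`…ForecastTransferArch`, p140186, worker S6 of cycle 4) with its five discharged hypotheses:

* H1 `forecastSwap_holds` (`…ForecastSwap`, p141614): the predictable-projection bound (`PredictableProjection`, PROVED, p124443) APPLIED under
  `LG` against `G_N` in the sequential start-cell filtration `Yseq` (exact σ-algebra identities `pastSigma_Yseq_eq_seqHist`,
  `pastSigma_Yseq_succ_eq_seqHistLE`, p140212), the tower property and the entropy budget `KL(LG‖G_N) ≤ A(N+1)` (`exists_lgTransferConst`,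
  p136396); remainder `T h³ √(2 M A (N+1)/K_N) → 0`;
* H2 `badForecastRare_of_forecastChaos` (`…ForecastBadForecastRare`, p143786): `MesoForecastChaos` verbatim + the in-mean entropy-inequality
  transfer;
* H3 `nonGoodRare_of` (`…ForecastNonGoodRare`, p143544, worker W1): occupied non-good cells are rare, from `CoarseLocalMaxwellianity`,
  `LocalCountUI` (ii) and `NoKineticIrregularity`;
* H4 `revealedSandwich_of` (`…RevealedSandwich`, p144080, worker W3): the revealed majorant / remainder of the increment by `sSup`/`sInf` over
  revealed-data atoms, the dictionary "the owned collision count is a function of the data revealed right after the unit, on the good set"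
  (`ownedCount_eq_of_seqHistLE_eq`, `…RevealedDictionary`, p142647) and `RevealedDefectStability` at `(Ψ, η/4, δ₄, T)`
  (`abs_unitDefect_sub_le_defectOsc`, `…RevealedDefectFacts`, p142789, worker W6);
* H5 `forecastAlgebra_holds` (`…ForecastAlgebra`, p144106, worker W2; means `…ForecastAlgebraMeans`, p142921): the conditional-expectation
  bookkeeping of one `N` (`LG ≪ G_N`, `LG ≪ liouville`, the pull-out `E_{G_N}[badWeight (k,q) | σ(seqHist k q)] = 0` a.e. on "cell `q` empty
  at `kΔ`").

KipnisLandim1999 A1.8 (entropy inequality), CoverThomas2006 §2.5 / PolyanskiyWu2024 Ch. 2 (chain rule) for the mechanism; everything else is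
bookkeeping landed in the files above.
-/

noncomputable section

open MeasureTheory Set Filter Topology
open scoped ENNReal BigOperators Classical
open Literature.Analysis.FluidPDE Literature.MathematicalPhysics.KineticTheory
open Literature.MathematicalPhysics.KineticTheory.VelocityBlindPlacement

namespace Summit.AtomisticToContinuum.HydrodynamicLimit.Theorems.EquilibriumForecastLine

/-- **Registered stub S6 `stub_forecastTransfer` of the line `equilibrium-forecast-chain-rule` (skeleton v5): the forecast transfer.**
Forecast chaos of good units under the INVARIANT law except on a large-deviation-rare space-time density of units (`MesoForecastChaos`),
local uniform integrability of the kinetic collision counts and the packing cap (`LocalCountUI`), no kinetic irregularity of occupied /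
void-adjacent cells (`NoKineticIrregularity`), local equilibrium at the kinetic-cell scale (`CoarseLocalMaxwellianity`) and revealed-defect
stability (`RevealedDefectStability`) under the EVOLVED law imply kinetic-cell chaos under the evolved law (`KineticCellChaosLG`): the
`localGibbsLaw`-expectation of the unit average of the truncated collision-weighted fraction of owned units whose marks fail the cross-ratio
test is small, `c ≥ c₀`, `N` large. Proof: the architecture `kineticCellChaosLG_of` with H1–H5 discharged (module docstring). [folklore] -/
theorem stub_forecastTransfer : MesoForecastChaos → LocalCountUI → NoKineticIrregularity → CoarseLocalMaxwellianity → RevealedDefectStability → KineticCellChaosLG :=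
  fun h2 h3 h4b h5 h8 =>
    kineticCellChaosLG_of forecastSwap_holds (badForecastRare_of_forecastChaos h2) (nonGoodRare_of h5 h3 h4b)
      (revealedSandwich_of h8) forecastAlgebra_holds

end Summit.AtomisticToContinuum.HydrodynamicLimit.Theorems.EquilibriumForecastLine

end
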